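import Literature.Analysis.FluidPDE.LambertCosineLaw
import Literature.Analysis.FluidPDE.LambertDoubling
import Literature.MathematicalPhysics.QuantumManyBody.CoarseModeRayPOVM
import HarnessLib

/-!
# The reflection pushforward on the sphere: `⟪a, ν⟫₊ dν` under `ν ↦ a - 2⟪a, ν⟫ ν` is `¼ dσ`

For a unit vector `a` of `ℝ³` and measurable `φ ≥ 0`,

`∫_{S²} ⟪a, ν⟫₊ φ(a - 2⟪a, ν⟫ ν) dσ(ν) = ¼ ∫_{S²} φ dσ`  (`lintegral_toSphere_cos_mul_comp_reflect`).

This is the conversion between the two standard parametrisations of a hard-sphere collision with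
relative velocity `z = |z| a`: the impact-direction (`ω`- or `ν`-) representation
`v' = v - ⟨z, ν⟩ ν`, kernel `⟨z, ν⟩₊ dν` (the tree's `hardSphereKernel`, `collide`), and the
`σ`-representation `v' = (v + v_*)/2 + |z| σ/2`, `σ = a - 2⟪a, ν⟫ ν`, kernel `(|z|/4) dσ`
(Cercignani–Illner–Pulvirenti 1994 §3.1; Villani, *A review of mathematical topics in collisional
kinetic theory* (2002) Ch. 1 §1.4, `B(z, σ) = |z|/4`… up to the normalisation of `dσ`). In the
`σ`-representation the angular average of `f(v') f(v_*')` is manifestly a function of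
`(v + v_*, |v|² + |v_*|²)` only, which is the starting point of the entropy-production estimates of
Toscani–Villani and Villani (Rezakhanlou–Villani, LNM 1916, Ch. 1 §1.4, Lemma 1).

Proof (no spherical coordinates): split `σ` into the hemispheres about `a` (the equator is null,
`toSphere_inner_eq_zero`); write each hemisphere integral in Lambert coordinates by the hat-box
theorem in flux form (`lintegral_toSphere_cos_comp_coords` of `LambertCosineLaw`, and rotation
invariance `measurePreserving_unitSphereMap` for the lower one); on the disc the reflected direction
is `lift a (double p)` (outer annulus) or its mirror image (inner disc), `double` the angle-doubling
map of `LambertDoubling`, whose Jacobian `4√(1 - ‖double p‖²)` produces exactly the factor `¼` and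
the hemisphere weights `(1 - ‖q‖²)^{-1/2}`.
-/

noncomputable section

open scoped BigOperators ENNReal Topology InnerProductSpace Pointwise
open MeasureTheory Set Filter Metric Real

namespace Literature.Analysis.FluidPDE

local notation "E²" => EuclideanSpace ℝ (Fin 2)
local notation "E³" => EuclideanSpace ℝ (Fin 3)



/-! ## The equator is null; hemispheres -/

/-- For `a ≠ 0` the great circle `{ν ∈ S² | ⟪a, ν⟫ = 0}` is null for the surface measure. [folklore] -/
theorem toSphere_inner_eq_zero {a : E³} (ha : a ≠ 0) :
    (volume : Measure E³).toSphere {ν : sphere (0 : E³) 1 | ⟪a, (ν : E³)⟫_ℝ = 0} = 0 := by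
  have hmeas : MeasurableSet {ν : sphere (0 : E³) 1 | ⟪a, (ν : E³)⟫_ℝ = 0} :=
    measurableSet_eq_fun (by fun_prop) measurable_const
  rw [Measure.toSphere_apply' _ hmeas]
  have hsub : Ioo (0 : ℝ) 1 • (((↑) : sphere (0 : E³) 1 → E³) '' {ν | ⟪a, (ν : E³)⟫_ℝ = 0}) ⊆
      ((ℝ ∙ a)ᗮ : Submodule ℝ E³) := by
    rintro x ⟨t, -, y, ⟨ν, hν, rfl⟩, rfl⟩
    rw [SetLike.mem_coe, Submodule.mem_orthogonal_singleton_iff_inner_right, inner_smul_right,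
      show ⟪a, (ν : E³)⟫_ℝ = 0 from hν, mul_zero]
  have hK : ((ℝ ∙ a)ᗮ : Submodule ℝ E³) ≠ ⊤ := by
    intro h
    have ha' : a ∈ ((ℝ ∙ a)ᗮ : Submodule ℝ E³) := h ▸ Submodule.mem_top
    rw [Submodule.mem_orthogonal_singleton_iff_inner_right, real_inner_self_eq_norm_sq] at ha'
    exact ha (norm_eq_zero.1 (pow_eq_zero_iff two_ne_zero |>.1 ha'))
  rw [measure_mono_null hsub (Measure.addHaar_submodule _ _ hK), mul_zero]

/-- Splitting a sphere integral into the two open hemispheres about `a ≠ 0` (the equator is null).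
[folklore] -/
theorem lintegral_toSphere_eq_add_hemispheres {a : E³} (ha : a ≠ 0) {φ : sphere (0 : E³) 1 → ℝ≥0∞}
    (hφ : Measurable φ) :
    ∫⁻ ν, φ ν ∂(volume : Measure E³).toSphere =
      ∫⁻ ν, (Ioi (0 : ℝ)).indicator (fun _ => (1 : ℝ≥0∞)) ⟪a, (ν : E³)⟫_ℝ * φ ν
          ∂(volume : Measure E³).toSphere +
        ∫⁻ ν, (Iio (0 : ℝ)).indicator (fun _ => (1 : ℝ≥0∞)) ⟪a, (ν : E³)⟫_ℝ * φ ν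
          ∂(volume : Measure E³).toSphere := by
  set σ := (volume : Measure E³).toSphere with hσ
  have hinner : Measurable fun ν : sphere (0 : E³) 1 => ⟪a, (ν : E³)⟫_ℝ := by fun_prop
  have hI : Measurable fun ν : sphere (0 : E³) 1 =>
      (Ioi (0 : ℝ)).indicator (fun _ => (1 : ℝ≥0∞)) ⟪a, (ν : E³)⟫_ℝ * φ ν :=
    ((measurable_const.indicator measurableSet_Ioi).comp hinner).mul hφ
  have hJ : Measurable fun ν : sphere (0 : E³) 1 =>
      (Iio (0 : ℝ)).indicator (fun _ => (1 : ℝ≥0∞)) ⟪a, (ν : E³)⟫_ℝ * φ ν :=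
    ((measurable_const.indicator measurableSet_Iio).comp hinner).mul hφ
  have hZ : ∫⁻ ν, ({ν : sphere (0 : E³) 1 | ⟪a, (ν : E³)⟫_ℝ = 0}).indicator φ ν ∂σ = 0 := by
    rw [lintegral_indicator (measurableSet_eq_fun hinner measurable_const), hσ,
      Measure.restrict_eq_zero.2 (toSphere_inner_eq_zero ha), lintegral_zero_measure]
  have hpt : ∀ ν : sphere (0 : E³) 1, φ ν =
      (Ioi (0 : ℝ)).indicator (fun _ => (1 : ℝ≥0∞)) ⟪a, (ν : E³)⟫_ℝ * φ ν +
        (Iio (0 : ℝ)).indicator (fun _ => (1 : ℝ≥0∞)) ⟪a, (ν : E³)⟫_ℝ * φ ν +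
          ({ν : sphere (0 : E³) 1 | ⟪a, (ν : E³)⟫_ℝ = 0}).indicator φ ν := by
    intro ν
    rcases lt_trichotomy ⟪a, (ν : E³)⟫_ℝ 0 with h | h | h
    · rw [indicator_of_notMem (show ⟪a, (ν : E³)⟫_ℝ ∉ Ioi (0 : ℝ) by simpa using h.le),
        indicator_of_mem (mem_Iio.2 h),
        indicator_of_notMem (show ν ∉ {ν : sphere (0 : E³) 1 | ⟪a, (ν : E³)⟫_ℝ = 0} by simp [h.ne])]
      simp
    · rw [indicator_of_notMem (show ⟪a, (ν : E³)⟫_ℝ ∉ Ioi (0 : ℝ) by simp [h]),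
        indicator_of_notMem (show ⟪a, (ν : E³)⟫_ℝ ∉ Iio (0 : ℝ) by simp [h]),
        indicator_of_mem (show ν ∈ {ν : sphere (0 : E³) 1 | ⟪a, (ν : E³)⟫_ℝ = 0} by simpa using h)]
      simp
    · rw [indicator_of_mem (mem_Ioi.2 h),
        indicator_of_notMem (show ⟪a, (ν : E³)⟫_ℝ ∉ Iio (0 : ℝ) by simpa using h.le),
        indicator_of_notMem (show ν ∉ {ν : sphere (0 : E³) 1 | ⟪a, (ν : E³)⟫_ℝ = 0} by simp [h.ne'])]
      simp
  calc ∫⁻ ν, φ ν ∂σ = ∫⁻ ν, ((Ioi (0 : ℝ)).indicator (fun _ => (1 : ℝ≥0∞)) ⟪a, (ν : E³)⟫_ℝ * φ ν +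
        (Iio (0 : ℝ)).indicator (fun _ => (1 : ℝ≥0∞)) ⟪a, (ν : E³)⟫_ℝ * φ ν +
          ({ν : sphere (0 : E³) 1 | ⟪a, (ν : E³)⟫_ℝ = 0}).indicator φ ν) ∂σ :=
        lintegral_congr hpt
    _ = _ := by
        rw [lintegral_add_right _ (hφ.indicator (measurableSet_eq_fun hinner measurable_const)),
          lintegral_add_left hI, hZ, add_zero]

/-- **Upper hemisphere in Lambert coordinates**: for unit `a` and measurable `φ ≥ 0` on `ℝ³`,
`∫_{⟪a,ν⟫>0} φ(ν) dσ(ν) = ∫_{‖p‖<1} φ(lift a p) (1 - ‖p‖²)^{-1/2} dp` (the hat-box theorem in flux form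
applied to `φ ∘ lift / ⟪a, ·⟫`). [folklore] -/
theorem lintegral_toSphere_upper_eq_lintegral_ball {a : E³} (ha : ‖a‖ = 1) {φ : E³ → ℝ≥0∞}
    (hφ : Measurable φ) :
    ∫⁻ ν, (Ioi (0 : ℝ)).indicator (fun _ => (1 : ℝ≥0∞)) ⟪a, (ν : E³)⟫_ℝ * φ ν
        ∂(volume : Measure E³).toSphere =
      ∫⁻ p in ball (0 : E²) 1, φ (Lambert.lift a p) / ENNReal.ofReal √(1 - ‖p‖ ^ 2) := by
  have hf : Measurable fun p : E² => φ (Lambert.lift a p) / ENNReal.ofReal √(1 - ‖p‖ ^ 2) :=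
    (hφ.comp (Lambert.measurable_lift a)).div (by fun_prop)
  rw [← lintegral_toSphere_cos_comp_coords ha hf]
  refine lintegral_congr fun ν => ?_
  have hν : ‖(ν : E³)‖ = 1 := by simp
  rcases le_or_gt ⟪a, (ν : E³)⟫_ℝ 0 with hle | hpos
  · rw [indicator_of_notMem (show ⟪a, (ν : E³)⟫_ℝ ∉ Ioi (0 : ℝ) by simpa using hle),
      ENNReal.ofReal_eq_zero.2 hle]
    simp
  · rw [indicator_of_mem (mem_Ioi.2 hpos), one_mul, Lambert.lift_coords ha hν hpos.le,
      Lambert.sqrt_one_sub_norm_sq_coords ha hν hpos.le,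
      ENNReal.mul_div_cancel (ENNReal.ofReal_pos.2 hpos).ne' ENNReal.ofReal_ne_top]

/-- The reflection `R_a ν = ν - 2⟪a, ν⟫ a` across the plane `a^⊥` (unit `a`), as the linear isometry
`((ℝ ∙ a)ᗮ).reflection` of Mathlib. [folklore] -/
theorem reflection_orthogonal_singleton_apply {a : E³} (ha : ‖a‖ = 1) (v : E³) :
    (ℝ ∙ a)ᗮ.reflection v = v - (2 * ⟪a, v⟫_ℝ) • a := by
  rw [Submodule.reflection_orthogonal_apply, Submodule.reflection_singleton_apply, ha]
  simp only [RCLike.ofReal_real_eq_id, id_eq, one_pow, div_one, neg_sub]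
  module

/-- **Lower hemisphere in Lambert coordinates**: for unit `a` and measurable `φ ≥ 0` on `ℝ³`,
`∫_{⟪a,ν⟫<0} φ(ν) dσ(ν) = ∫_{‖p‖<1} φ(lift a p - 2√(1-‖p‖²) a) (1 - ‖p‖²)^{-1/2} dp`, by reflecting the
upper-hemisphere formula across `a^⊥` (rotation invariance of `σ`). [folklore] -/
theorem lintegral_toSphere_lower_eq_lintegral_ball {a : E³} (ha : ‖a‖ = 1) {φ : E³ → ℝ≥0∞}
    (hφ : Measurable φ) :
    ∫⁻ ν, (Iio (0 : ℝ)).indicator (fun _ => (1 : ℝ≥0∞)) ⟪a, (ν : E³)⟫_ℝ * φ ν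
        ∂(volume : Measure E³).toSphere =
      ∫⁻ p in ball (0 : E²) 1,
        φ (Lambert.lift a p - (2 * √(1 - ‖p‖ ^ 2)) • a) / ENNReal.ofReal √(1 - ‖p‖ ^ 2) := by
  set R : E³ ≃ₗᵢ[ℝ] E³ := (ℝ ∙ a)ᗮ.reflection with hR
  have hRa : ∀ v : E³, R v = v - (2 * ⟪a, v⟫_ℝ) • a := reflection_orthogonal_singleton_apply ha
  have hinnerR : ∀ v : E³, ⟪a, R v⟫_ℝ = -⟪a, v⟫_ℝ := fun v => by
    rw [hRa, inner_sub_right, real_inner_smul_right, real_inner_self_eq_norm_sq, ha]; ring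
  -- change variables ν ↦ R ν on the sphere
  have hmp := Literature.MathematicalPhysics.QuantumManyBody.BoseGas.measurePreserving_unitSphereMap
    (E := E³) R
  have hmeas : Measurable fun ν : sphere (0 : E³) 1 =>
      (Iio (0 : ℝ)).indicator (fun _ => (1 : ℝ≥0∞)) ⟪a, (ν : E³)⟫_ℝ * φ ν :=
    ((measurable_const.indicator measurableSet_Iio).comp (by fun_prop)).mul
      (hφ.comp measurable_subtype_coe)
  rw [← hmp.lintegral_comp hmeas]
  simp only [Literature.MathematicalPhysics.QuantumManyBody.BoseGas.coe_unitSphereMap, hinnerR]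
  have hind : ∀ t : ℝ, (Iio (0 : ℝ)).indicator (fun _ => (1 : ℝ≥0∞)) (-t) =
      (Ioi (0 : ℝ)).indicator (fun _ => (1 : ℝ≥0∞)) t := fun t => by
    by_cases ht : 0 < t
    · rw [indicator_of_mem (show -t ∈ Iio (0 : ℝ) by simpa using ht), indicator_of_mem (mem_Ioi.2 ht)]
    · rw [indicator_of_notMem (show -t ∉ Iio (0 : ℝ) by simpa using ht),
        indicator_of_notMem (show t ∉ Ioi (0 : ℝ) from ht)]
  simp_rw [hind]
  have hup : ∫⁻ ν, (Ioi (0 : ℝ)).indicator (fun _ => (1 : ℝ≥0∞)) ⟪a, (ν : E³)⟫_ℝ * φ (R ν)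
      ∂(volume : Measure E³).toSphere =
      ∫⁻ p in ball (0 : E²) 1, φ (R (Lambert.lift a p)) / ENNReal.ofReal √(1 - ‖p‖ ^ 2) :=
    lintegral_toSphere_upper_eq_lintegral_ball ha (hφ.comp R.continuous.measurable)
  rw [hup]
  refine setLIntegral_congr_fun measurableSet_ball fun p hp => ?_
  rw [hRa, real_inner_comm, Lambert.inner_lift_self ha]


/-! ## The reflection pushforward -/

namespace Lambert

/-- `double` is continuous. [folklore] -/
theorem continuous_double : Continuous double := by
  unfold double; fun_prop

/-- **The reflected direction in Lambert coordinates, outer annulus**: for any `a` and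
`1/2 < ‖p‖² < 1`, `a - 2⟪a, lift a p⟫ lift a p = lift a (double p)`. [folklore] -/
theorem reflect_lift_outer (a : E³) {p : E²} (hp1 : 1 / 2 < ‖p‖ ^ 2) (hp2 : ‖p‖ < 1) :
    a - (2 * √(1 - ‖p‖ ^ 2)) • lift a p = lift a (double p) := by
  set c := √(1 - ‖p‖ ^ 2) with hc
  have hc2 : c ^ 2 = 1 - ‖p‖ ^ 2 := Real.sq_sqrt (by nlinarith [norm_nonneg p])
  have habs : |1 - 2 * ‖p‖ ^ 2| = 2 * ‖p‖ ^ 2 - 1 := by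
    rw [abs_of_neg (by linarith)]; ring
  rw [lift, lift, sqrt_one_sub_norm_sq_double hp2.le, habs, double, embed_smul, ← hc, smul_add,
    smul_smul, show 2 * c * c = 2 - 2 * ‖p‖ ^ 2 by nlinarith [hc2]]
  module

/-- **The reflected direction in Lambert coordinates, inner disc**: for any `a` and `‖p‖² < 1/2`,
`a - 2⟪a, lift a p⟫ lift a p = lift a (double p) - 2√(1-‖double p‖²) a` (lower hemisphere).
[folklore] -/
theorem reflect_lift_inner (a : E³) {p : E²} (hp1 : ‖p‖ ^ 2 < 1 / 2) :
    a - (2 * √(1 - ‖p‖ ^ 2)) • lift a p =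
      lift a (double p) - (2 * √(1 - ‖double p‖ ^ 2)) • a := by
  have hp2 : ‖p‖ < 1 := by nlinarith [norm_nonneg p]
  set c := √(1 - ‖p‖ ^ 2) with hc
  have hc2 : c ^ 2 = 1 - ‖p‖ ^ 2 := Real.sq_sqrt (by nlinarith [norm_nonneg p])
  have habs : |1 - 2 * ‖p‖ ^ 2| = 1 - 2 * ‖p‖ ^ 2 := abs_of_pos (by linarith)
  rw [lift, lift, sqrt_one_sub_norm_sq_double hp2.le, habs, double, embed_smul, ← hc, smul_add,
    smul_smul, show 2 * c * c = 2 - 2 * ‖p‖ ^ 2 by nlinarith [hc2]]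
  module

end Lambert

/-- `X / (4 Y) = ¼ (X / Y)` in `ℝ≥0∞`. [folklore] -/
theorem ennreal_div_ofReal_four_mul (X : ℝ≥0∞) (y : ℝ) :
    X / ENNReal.ofReal (4 * y) = 4⁻¹ * (X / ENNReal.ofReal y) := by
  rcases le_or_gt y 0 with hy | hy
  · rw [ENNReal.ofReal_eq_zero.2 hy, ENNReal.ofReal_eq_zero.2 (by linarith)]
    rcases eq_or_ne X 0 with hX | hX
    · simp [hX]
    · simp [ENNReal.div_zero hX]
  rw [ENNReal.ofReal_mul (by norm_num : (0 : ℝ) ≤ 4), ENNReal.ofReal_ofNat, div_eq_mul_inv,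
    div_eq_mul_inv, ENNReal.mul_inv (Or.inl (by norm_num)) (Or.inl (by simp))]
  ring

/-- The open unit disc is, up to a null set (the origin and the circle `‖p‖² = 1/2`), the disjoint
union of the inner disc `{p ≠ 0, ‖p‖² < 1/2}` and the outer annulus `{1/2 < ‖p‖², ‖p‖ < 1}`:
splitting of a Lebesgue integral. [folklore] -/
theorem lintegral_ball_eq_inner_add_outer (F : E² → ℝ≥0∞) (hF : Measurable F) :
    ∫⁻ p in ball (0 : E²) 1, F p =
      (∫⁻ p in {p : E² | p ≠ 0 ∧ ‖p‖ ^ 2 < 1 / 2}, F p) +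
        ∫⁻ p in {p : E² | 1 / 2 < ‖p‖ ^ 2 ∧ ‖p‖ < 1}, F p := by
  have hIn : MeasurableSet {p : E² | p ≠ 0 ∧ ‖p‖ ^ 2 < 1 / 2} :=
    (isOpen_compl_singleton.inter (isOpen_lt (continuous_norm.pow 2) continuous_const)).measurableSet
  have hOut : MeasurableSet {p : E² | 1 / 2 < ‖p‖ ^ 2 ∧ ‖p‖ < 1} :=
    ((isOpen_lt continuous_const (continuous_norm.pow 2)).inter
      (isOpen_lt continuous_norm continuous_const)).measurableSet
  -- the null set
  have hnull : volume (({0} : Set E²) ∪ sphere (0 : E²) (√(1 / 2))) = 0 :=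
    measure_union_null (measure_singleton 0) (Measure.addHaar_sphere volume 0 _)
  rw [← lintegral_indicator measurableSet_ball, ← lintegral_indicator hIn, ← lintegral_indicator hOut,
    ← lintegral_add_left (hF.indicator hIn)]
  refine lintegral_congr_ae ?_
  filter_upwards [measure_eq_zero_iff_ae_notMem.1 hnull] with p hp
  simp only [mem_union, mem_singleton_iff, mem_sphere, dist_zero_right, not_or] at hp
  have ht : ‖p‖ ^ 2 ≠ 1 / 2 := by
    intro h
    apply hp.2
    rw [← Real.sqrt_sq (norm_nonneg p), h]
  by_cases hb : ‖p‖ < 1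
  · rw [indicator_of_mem (mem_ball_zero_iff.2 hb)]
    rcases lt_or_gt_of_ne ht with hlt | hgt
    · rw [indicator_of_mem (show p ∈ {p : E² | p ≠ 0 ∧ ‖p‖ ^ 2 < 1 / 2} from ⟨hp.1, hlt⟩),
        indicator_of_notMem (show p ∉ {p : E² | 1 / 2 < ‖p‖ ^ 2 ∧ ‖p‖ < 1} from
          fun h => absurd h.1 (by linarith)), add_zero]
    · rw [indicator_of_notMem (show p ∉ {p : E² | p ≠ 0 ∧ ‖p‖ ^ 2 < 1 / 2} from
          fun h => absurd h.2 (by linarith)),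
        indicator_of_mem (show p ∈ {p : E² | 1 / 2 < ‖p‖ ^ 2 ∧ ‖p‖ < 1} from ⟨hgt, hb⟩), zero_add]
  · rw [indicator_of_notMem (show p ∉ ball (0 : E²) 1 by simpa using hb),
      indicator_of_notMem (show p ∉ {p : E² | p ≠ 0 ∧ ‖p‖ ^ 2 < 1 / 2} from
        fun h => hb (by nlinarith [norm_nonneg p, h.2])),
      indicator_of_notMem (show p ∉ {p : E² | 1 / 2 < ‖p‖ ^ 2 ∧ ‖p‖ < 1} from fun h => hb h.2),
      add_zero]

/-- **The reflection pushforward on the sphere** (`ω`-representation versus `σ`-representation of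
hard-sphere collisions in `ℝ³`): for a unit vector `a` and measurable `φ ≥ 0` on `ℝ³`,
`∫_{S²} ⟪a, ν⟫₊ φ(a - 2⟪a, ν⟫ ν) dσ(ν) = ¼ ∫_{S²} φ dσ`.
In words: if `ν` is distributed on the hemisphere `⟪a, ν⟫ > 0` with the cosine (flux) density
`⟪a, ν⟫ dσ(ν)` (total mass `π`), then the reflected direction `a - 2⟪a, ν⟫ ν` (the direction of the
post-collisional relative velocity `v' - v_*' = z - 2⟨z, ν⟩ν` when `a = z/|z|`) is uniformly distributed
on the sphere (total mass `¼ · 4π = π`). This is the Jacobian `dσ = 4 |⟪a, ν⟫| dν` of the two-to-one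
map `ν ↦ σ = a - 2⟪a,ν⟫ν`, i.e. the classical conversion `B(z, ν) dν = |⟨z, ν⟩| dν ↔ (|z|/4)… dσ`
between the two standard parametrisations of hard-sphere collisions (Cercignani–Illner–Pulvirenti
1994 §3.1; Villani 2002 Ch. 1 §1.4). Proof: hat-box theorem in flux form (`LambertCosineLaw`),
the angle-doubling map `Lambert.double` of the disc with Jacobian `4|1 - 2‖p‖²| = 4√(1-‖double p‖²)`,
and rotation invariance of `σ`. [folklore] -/
theorem lintegral_toSphere_cos_mul_comp_reflect {a : E³} (ha : ‖a‖ = 1) {φ : E³ → ℝ≥0∞}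
    (hφ : Measurable φ) :
    ∫⁻ ν : sphere (0 : E³) 1,
        ENNReal.ofReal ⟪a, (ν : E³)⟫_ℝ * φ (a - (2 * ⟪a, (ν : E³)⟫_ℝ) • (ν : E³))
          ∂(volume : Measure E³).toSphere =
      4⁻¹ * ∫⁻ ν : sphere (0 : E³) 1, φ ν ∂(volume : Measure E³).toSphere := by
  have ha0 : a ≠ 0 := fun h => by rw [h, norm_zero] at ha; exact zero_ne_one ha
  -- Step 1: hat-box
  set Ψ : E² → E³ := fun p => a - (2 * √(1 - ‖p‖ ^ 2)) • Lambert.lift a p with hΨ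
  have hcoef : Measurable fun p : E² => 2 * √(1 - ‖p‖ ^ 2) := by fun_prop
  have hΨm : Measurable Ψ := measurable_const.sub (hcoef.smul (Lambert.measurable_lift a))
  have step1 : ∫⁻ ν : sphere (0 : E³) 1,
      ENNReal.ofReal ⟪a, (ν : E³)⟫_ℝ * φ (a - (2 * ⟪a, (ν : E³)⟫_ℝ) • (ν : E³))
        ∂(volume : Measure E³).toSphere = ∫⁻ p in ball (0 : E²) 1, φ (Ψ p) := by
    have hb : ∫⁻ ν : sphere (0 : E³) 1, ENNReal.ofReal ⟪a, (ν : E³)⟫_ℝ * φ (Ψ (Lambert.coords a ν))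
        ∂(volume : Measure E³).toSphere = ∫⁻ p in ball (0 : E²) 1, φ (Ψ p) :=
      lintegral_toSphere_cos_comp_coords ha (hφ.comp hΨm)
    rw [← hb]
    refine lintegral_congr fun ν => ?_
    have hν : ‖(ν : E³)‖ = 1 := by simp
    rcases le_or_gt ⟪a, (ν : E³)⟫_ℝ 0 with hle | hpos
    · rw [ENNReal.ofReal_eq_zero.2 hle, zero_mul, zero_mul]
    · simp only [hΨ]
      rw [Lambert.lift_coords ha hν hpos.le, Lambert.sqrt_one_sub_norm_sq_coords ha hν hpos.le]
  -- Step 2: split the disc and change variables on each piece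
  have hGout : Measurable fun q : E² => φ (Lambert.lift a q) := hφ.comp (Lambert.measurable_lift a)
  have hGin : Measurable fun q : E² => φ (Lambert.lift a q - (2 * √(1 - ‖q‖ ^ 2)) • a) :=
    hφ.comp ((Lambert.measurable_lift a).sub (hcoef.smul measurable_const))
  have hout : ∫⁻ p in {p : E² | 1 / 2 < ‖p‖ ^ 2 ∧ ‖p‖ < 1}, φ (Ψ p) =
      4⁻¹ * ∫⁻ ν, (Ioi (0 : ℝ)).indicator (fun _ => (1 : ℝ≥0∞)) ⟪a, (ν : E³)⟫_ℝ * φ ν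
        ∂(volume : Measure E³).toSphere := by
    rw [lintegral_toSphere_upper_eq_lintegral_ball ha hφ]
    have hOut : MeasurableSet {p : E² | 1 / 2 < ‖p‖ ^ 2 ∧ ‖p‖ < 1} :=
      ((isOpen_lt continuous_const (continuous_norm.pow 2)).inter
        (isOpen_lt continuous_norm continuous_const)).measurableSet
    calc ∫⁻ p in {p : E² | 1 / 2 < ‖p‖ ^ 2 ∧ ‖p‖ < 1}, φ (Ψ p)
        = ∫⁻ p in {p : E² | 1 / 2 < ‖p‖ ^ 2 ∧ ‖p‖ < 1}, φ (Lambert.lift a (Lambert.double p)) :=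
          setLIntegral_congr_fun hOut fun p hp => by
            simp only [hΨ]; rw [Lambert.reflect_lift_outer a hp.1 hp.2]
      _ = ∫⁻ q in ball (0 : E²) 1, φ (Lambert.lift a q) / ENNReal.ofReal (4 * √(1 - ‖q‖ ^ 2)) :=
          Lambert.lintegral_comp_double_outer (fun q => φ (Lambert.lift a q))
      _ = ∫⁻ q in ball (0 : E²) 1, 4⁻¹ * (φ (Lambert.lift a q) / ENNReal.ofReal √(1 - ‖q‖ ^ 2)) := by
          simp_rw [ennreal_div_ofReal_four_mul]
      _ = _ := by rw [lintegral_const_mul' _ _ (by simp)]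
  have hin : ∫⁻ p in {p : E² | p ≠ 0 ∧ ‖p‖ ^ 2 < 1 / 2}, φ (Ψ p) =
      4⁻¹ * ∫⁻ ν, (Iio (0 : ℝ)).indicator (fun _ => (1 : ℝ≥0∞)) ⟪a, (ν : E³)⟫_ℝ * φ ν
        ∂(volume : Measure E³).toSphere := by
    rw [lintegral_toSphere_lower_eq_lintegral_ball ha hφ]
    have hIn : MeasurableSet {p : E² | p ≠ 0 ∧ ‖p‖ ^ 2 < 1 / 2} :=
      (isOpen_compl_singleton.inter (isOpen_lt (continuous_norm.pow 2) continuous_const)).measurableSet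
    calc ∫⁻ p in {p : E² | p ≠ 0 ∧ ‖p‖ ^ 2 < 1 / 2}, φ (Ψ p)
        = ∫⁻ p in {p : E² | p ≠ 0 ∧ ‖p‖ ^ 2 < 1 / 2},
            φ (Lambert.lift a (Lambert.double p) - (2 * √(1 - ‖Lambert.double p‖ ^ 2)) • a) :=
          setLIntegral_congr_fun hIn fun p hp => by
            simp only [hΨ]; rw [Lambert.reflect_lift_inner a hp.2]
      _ = ∫⁻ q in ball (0 : E²) 1, φ (Lambert.lift a q - (2 * √(1 - ‖q‖ ^ 2)) • a) /
            ENNReal.ofReal (4 * √(1 - ‖q‖ ^ 2)) :=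
          Lambert.lintegral_comp_double_inner (fun q => φ (Lambert.lift a q - (2 * √(1 - ‖q‖ ^ 2)) • a))
      _ = ∫⁻ q in ball (0 : E²) 1, 4⁻¹ * (φ (Lambert.lift a q - (2 * √(1 - ‖q‖ ^ 2)) • a) /
            ENNReal.ofReal √(1 - ‖q‖ ^ 2)) := by
          simp_rw [ennreal_div_ofReal_four_mul]
      _ = _ := by rw [lintegral_const_mul' _ _ (by simp)]
  have hsplit : ∫⁻ p in ball (0 : E²) 1, φ (Ψ p) =
      (∫⁻ p in {p : E² | p ≠ 0 ∧ ‖p‖ ^ 2 < 1 / 2}, φ (Ψ p)) +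
        ∫⁻ p in {p : E² | 1 / 2 < ‖p‖ ^ 2 ∧ ‖p‖ < 1}, φ (Ψ p) :=
    lintegral_ball_eq_inner_add_outer (fun p => φ (Ψ p)) (hφ.comp hΨm)
  have hhemi : ∫⁻ ν : sphere (0 : E³) 1, φ ν ∂(volume : Measure E³).toSphere =
      ∫⁻ ν, (Ioi (0 : ℝ)).indicator (fun _ => (1 : ℝ≥0∞)) ⟪a, (ν : E³)⟫_ℝ * φ ν
          ∂(volume : Measure E³).toSphere +
        ∫⁻ ν, (Iio (0 : ℝ)).indicator (fun _ => (1 : ℝ≥0∞)) ⟪a, (ν : E³)⟫_ℝ * φ ν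
          ∂(volume : Measure E³).toSphere :=
    lintegral_toSphere_eq_add_hemispheres ha0 (hφ.comp measurable_subtype_coe)
  rw [step1, hsplit, hin, hout, ← mul_add, hhemi, add_comm]

end Literature.Analysis.FluidPDE

end
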